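import Literature.AlgebraicGeometry.Frobenioids.Categories
import Mathlib.Data.Finite.Sum
import Mathlib.Data.Countable.Basic
import HarnessLib

/-!
# Frobenioids I, §0: the coproduct completions `C^⊥`, `C^⊤` — first properties (§0 residual of
# the STEP-0 fragment; abc-iut cell, layer L1)

Mochizuki, *The geometry of Frobenioids I: the general theory*, Kyushu J. Math. **62** (2008)
293–400, §0 "Categories", kurims text p. 16 [cite: MochizukiFrdI2008, §0 p.16]:

> "Thus, `C^⊥` (respectively, `C^⊤`) is a category of finitely (respectively, countably)
> connected type. Note that objects of `C` define connected objects of `C^⊥` or `C^⊤`. Moreover,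
> there are natural [up to isomorphism] equivalences of categories `(C^⊥)⁰ ⥲ C`; `(C^⊤)⁰ ⥲ C`;
> `(D⁰)^⊥ ⥲ D`; `(E⁰)^⊤ ⥲ E` […]. If `C` is a totally epimorphic category, then `C^⊥`
> (respectively, `C^⊤`) is an almost totally epimorphic category of finitely (respectively,
> countably) connected type."

`C^⊥ = FiniteCoproductCompletion C` and `C^⊤ = CountableCoproductCompletion C` are the full
subcategories of Mathlib's `FormalCoproduct C` cut out by finiteness / countability of the index
set (`Categories.lean`). This file proves, uniformly for any full subcategory
`P.FullSubcategory ⊆ FormalCoproduct C` containing the empty and the two-point formal coproducts: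
an object with empty index set is initial; a non-initial object has nonempty index set; the
one-point objects `incl A` are nonempty and **connected** (the printed claim "objects of `C` define
connected objects of `C^⊥` or `C^⊤`"), by a direct two-point separation argument; and explicit
binary coproducts. Deliberately NOT here (statements deferred to a later file): "`C^⊥` is of
finitely connected type", the four equivalences `(C^⊥)⁰ ⥲ C`, …, and "totally epimorphic ⇒
`C^⊥` almost totally epimorphic". No statement of the paper is strengthened.
-/

namespace Literature.AlgebraicGeometry.Frobenioids

open CategoryTheory Limits

universe w v u

variable {C : Type u} [Category.{v} C]

namespace CoproductCompletion

variable (P : ObjectProperty (FormalCoproduct.{w} C))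

/-! ### Empty index sets: initial objects -/

/-- The empty formal coproduct. [cite: MochizukiFrdI2008, §0 p.16] -/
def empty : FormalCoproduct.{w} C := ⟨PEmpty.{w + 1}, fun i => PEmpty.elim i⟩

/-- The two-point formal coproduct `A ⊔ A`. [cite: MochizukiFrdI2008, §0 p.16] -/
def twoPoint (A : C) : FormalCoproduct.{w} C := ⟨PUnit.{w + 1} ⊕ PUnit.{w + 1}, fun _ => A⟩

variable {P}

/-- In a full subcategory of `FormalCoproduct C`, an object with empty index set is initial (maps
out of it are unique). [cite: MochizukiFrdI2008, §0 p.16] -/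
def isInitialOfIsEmpty (X : P.FullSubcategory) [IsEmpty X.obj.I] : IsInitial X :=
  IsInitial.ofUniqueHom
    (fun _ => ObjectProperty.homMk ⟨fun i => isEmptyElim i, fun i => isEmptyElim i⟩)
    fun _ _ => ObjectProperty.hom_ext _
      (FormalCoproduct.hom_ext (funext fun i => isEmptyElim i) fun i => isEmptyElim i)

/-- A nonempty (= non-initial) object has a nonempty index set. [cite: MochizukiFrdI2008, §0 p.16] -/
theorem nonempty_index_of_isNonemptyObj {X : P.FullSubcategory} (h : IsNonemptyObj X) :
    Nonempty X.obj.I := by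
  by_contra h'
  haveI : IsEmpty X.obj.I := not_nonempty_iff.mp h'
  exact h.false (isInitialOfIsEmpty X)

/-- The one-point object `incl A` is nonempty (non-initial), provided the subcategory contains the
empty formal coproduct. [cite: MochizukiFrdI2008, §0 p.16] -/
theorem isNonemptyObj_incl (hE : P empty) (A : C) (hA : P ((FormalCoproduct.incl C).obj A)) :
    IsNonemptyObj (⟨(FormalCoproduct.incl C).obj A, hA⟩ : P.FullSubcategory) :=
  ⟨fun h => PEmpty.elim ((h.to ⟨empty, hE⟩).hom.f PUnit.unit)⟩

/-! ### Explicit binary coproducts -/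

/-- The formal coproduct with index set the disjoint union. [cite: MochizukiFrdI2008, §0 p.16] -/
def sum (X Y : FormalCoproduct.{w} C) : FormalCoproduct.{w} C := ⟨X.I ⊕ Y.I, Sum.elim X.obj Y.obj⟩

/-- First coprojection `X → X ⊔ Y`. [cite: MochizukiFrdI2008, §0 p.16] -/
def sumInl (X Y : FormalCoproduct.{w} C) : X ⟶ sum X Y := ⟨Sum.inl, fun i => 𝟙 (X.obj i)⟩

/-- Second coprojection `Y → X ⊔ Y`. [cite: MochizukiFrdI2008, §0 p.16] -/
def sumInr (X Y : FormalCoproduct.{w} C) : Y ⟶ sum X Y := ⟨Sum.inr, fun j => 𝟙 (Y.obj j)⟩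

/-- The map out of `X ⊔ Y` determined by maps out of `X` and `Y`. [cite: MochizukiFrdI2008, §0 p.16] -/
def sumDesc {X Y Z : FormalCoproduct.{w} C} (f : X ⟶ Z) (g : Y ⟶ Z) : sum X Y ⟶ Z :=
  ⟨Sum.elim f.f g.f, fun i => match i with
    | Sum.inl i => f.φ i
    | Sum.inr j => g.φ j⟩

/-- `(X → X ⊔ Y → Z) = f`. [cite: MochizukiFrdI2008, §0 p.16] -/
theorem sumInl_sumDesc {X Y Z : FormalCoproduct.{w} C} (f : X ⟶ Z) (g : Y ⟶ Z) :
    sumInl X Y ≫ sumDesc f g = f :=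
  FormalCoproduct.hom_ext rfl fun i => by
    show (𝟙 _ ≫ f.φ i) ≫ eqToHom rfl = f.φ i
    rw [Category.id_comp, eqToHom_refl, Category.comp_id]

/-- `(Y → X ⊔ Y → Z) = g`. [cite: MochizukiFrdI2008, §0 p.16] -/
theorem sumInr_sumDesc {X Y Z : FormalCoproduct.{w} C} (f : X ⟶ Z) (g : Y ⟶ Z) :
    sumInr X Y ≫ sumDesc f g = g :=
  FormalCoproduct.hom_ext rfl fun j => by
    show (𝟙 _ ≫ g.φ j) ≫ eqToHom rfl = g.φ j
    rw [Category.id_comp, eqToHom_refl, Category.comp_id]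

/-- Uniqueness of the map out of `X ⊔ Y`. [cite: MochizukiFrdI2008, §0 p.16] -/
theorem sumDesc_unique {X Y Z : FormalCoproduct.{w} C} (m : sum X Y ⟶ Z) :
    m = sumDesc (sumInl X Y ≫ m) (sumInr X Y ≫ m) := by
  refine FormalCoproduct.hom_ext (funext fun i => ?_) fun i => ?_
  · rcases i with i | j
    · rfl
    · rfl
  · rcases i with i | j
    · show m.φ (Sum.inl i) ≫ eqToHom _ = 𝟙 _ ≫ m.φ (Sum.inl i)
      rw [eqToHom_refl, Category.comp_id, Category.id_comp]
    · show m.φ (Sum.inr j) ≫ eqToHom _ = 𝟙 _ ≫ m.φ (Sum.inr j)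
      rw [eqToHom_refl, Category.comp_id, Category.id_comp]

/-- `X ⊔ Y` with its coprojections is a coproduct in `FormalCoproduct C` ("`Hom(∐ Aᵢ, ∐ Bⱼ) =
∏ᵢ ∐ⱼ Hom(Aᵢ, Bⱼ)`"). [cite: MochizukiFrdI2008, §0 p.16] -/
def sumIsColimit (X Y : FormalCoproduct.{w} C) : IsColimit (BinaryCofan.mk (sumInl X Y) (sumInr X Y)) :=
  BinaryCofan.IsColimit.mk _ (fun f g => sumDesc f g)
    (fun f g => sumInl_sumDesc f g)
    (fun f g => sumInr_sumDesc f g)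
    (fun f g m h₁ h₂ => by
      rw [sumDesc_unique m]
      exact congrArg₂ sumDesc h₁ h₂)

/-- The same binary coproduct inside a full subcategory containing `X ⊔ Y`.
[cite: MochizukiFrdI2008, §0 p.16] -/
def sumIsColimitSub (X Y : P.FullSubcategory) (hXY : P (sum X.obj Y.obj)) :
    IsColimit (BinaryCofan.mk
      (ObjectProperty.homMk (sumInl X.obj Y.obj) : X ⟶ ⟨sum X.obj Y.obj, hXY⟩)
      (ObjectProperty.homMk (sumInr X.obj Y.obj) : Y ⟶ ⟨sum X.obj Y.obj, hXY⟩)) :=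
  BinaryCofan.IsColimit.mk _ (fun f g => ObjectProperty.homMk (sumDesc f.hom g.hom))
    (fun f g => ObjectProperty.hom_ext _ (sumInl_sumDesc f.hom g.hom))
    (fun f g => ObjectProperty.hom_ext _ (sumInr_sumDesc f.hom g.hom))
    (fun f g m h₁ h₂ => ObjectProperty.hom_ext _ (by
      have e₁ : sumInl X.obj Y.obj ≫ m.hom = f.hom := congrArg InducedCategory.Hom.hom h₁
      have e₂ : sumInr X.obj Y.obj ≫ m.hom = g.hom := congrArg InducedCategory.Hom.hom h₂
      show m.hom = sumDesc f.hom g.hom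
      rw [sumDesc_unique m.hom, e₁, e₂]))

/-! ### "Objects of `C` define connected objects of `C^⊥` or `C^⊤`" -/

/-- If `A ← B₁, A ← B₂` is a binary coproduct diagram in a full subcategory of `FormalCoproduct C`
with point the one-point object `incl A` and the subcategory contains `A ⊔ A`, then one of `B₁`,
`B₂` has empty index set (separate the two summands by the two maps `incl A ⇉ A ⊔ A`).
[cite: MochizukiFrdI2008, §0 p.16] -/
theorem isEmpty_or_isEmpty_of_isColimit (A : C) (hA : P ((FormalCoproduct.incl C).obj A))
    (hT : P (twoPoint A)) {B₁ B₂ : P.FullSubcategory}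
    (ι₁ : B₁ ⟶ ⟨(FormalCoproduct.incl C).obj A, hA⟩) (ι₂ : B₂ ⟶ ⟨(FormalCoproduct.incl C).obj A, hA⟩)
    (hc : IsColimit (BinaryCofan.mk ι₁ ι₂)) : IsEmpty B₁.obj.I ∨ IsEmpty B₂.obj.I := by
  by_contra h
  rw [not_or, not_isEmpty_iff, not_isEmpty_iff] at h
  obtain ⟨⟨i₁⟩, ⟨i₂⟩⟩ := h
  -- the two maps `incl A ⇉ A ⊔ A`
  let T : P.FullSubcategory := ⟨twoPoint A, hT⟩
  let u : (⟨(FormalCoproduct.incl C).obj A, hA⟩ : P.FullSubcategory) ⟶ T :=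
    ObjectProperty.homMk ⟨fun _ => Sum.inl PUnit.unit, fun _ => 𝟙 A⟩
  let v : (⟨(FormalCoproduct.incl C).obj A, hA⟩ : P.FullSubcategory) ⟶ T :=
    ObjectProperty.homMk ⟨fun _ => Sum.inr PUnit.unit, fun _ => 𝟙 A⟩
  obtain ⟨m, hm₁, hm₂⟩ := BinaryCofan.IsColimit.desc' hc (ι₁ ≫ u) (ι₂ ≫ v)
  have h₁ : m.hom.f PUnit.unit = Sum.inl PUnit.unit :=
    congrArg (fun k : B₁ ⟶ T => k.hom.f i₁) hm₁
  have h₂ : m.hom.f PUnit.unit = Sum.inr PUnit.unit :=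
    congrArg (fun k : B₂ ⟶ T => k.hom.f i₂) hm₂
  rw [h₁] at h₂
  exact Sum.inl_ne_inr h₂

/-- **"Objects of `C` define connected objects"** of any full subcategory of `FormalCoproduct C`
containing the empty and two-point formal coproducts. [cite: MochizukiFrdI2008, §0 p.16] -/
theorem isConnectedObj_incl (hE : P empty) (A : C) (hA : P ((FormalCoproduct.incl C).obj A))
    (hT : P (twoPoint A)) :
    IsConnectedObj (⟨(FormalCoproduct.incl C).obj A, hA⟩ : P.FullSubcategory) := by
  refine ⟨isNonemptyObj_incl hE A hA, fun B₁ B₂ ι₁ ι₂ hB₁ hB₂ => ⟨fun hc => ?_⟩⟩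
  rcases isEmpty_or_isEmpty_of_isColimit A hA hT ι₁ ι₂ hc with h | h
  · exact (nonempty_index_of_isNonemptyObj hB₁).elim fun i => h.false i
  · exact (nonempty_index_of_isNonemptyObj hB₂).elim fun i => h.false i

end CoproductCompletion

/-! ### The instances `C^⊥` and `C^⊤` -/

open CoproductCompletion

/-- "Objects of `C` define connected objects of `C^⊥`" (FrdI §0 p. 16). [cite: MochizukiFrdI2008, §0 p.16] -/
theorem isConnectedObj_toFiniteCoproductCompletion (A : C) :
    IsConnectedObj ((toFiniteCoproductCompletion.{w} C).obj A) :=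
  isConnectedObj_incl (P := finiteFormalCoproducts.{w} C)
    (show Finite PEmpty.{w + 1} from inferInstance) A
    (show Finite PUnit.{w + 1} from inferInstance)
    (show Finite (PUnit.{w + 1} ⊕ PUnit.{w + 1}) from inferInstance)

/-- "Objects of `C` define connected objects of `C^⊤`" (FrdI §0 p. 16). [cite: MochizukiFrdI2008, §0 p.16] -/
theorem isConnectedObj_toCountableCoproductCompletion (A : C) :
    IsConnectedObj ((toCountableCoproductCompletion.{w} C).obj A) :=
  isConnectedObj_incl (P := countableFormalCoproducts.{w} C)
    (show Countable PEmpty.{w + 1} from inferInstance) A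
    (show Countable PUnit.{w + 1} from inferInstance)
    (show Countable (PUnit.{w + 1} ⊕ PUnit.{w + 1}) from inferInstance)

/-- `C^⊥` has the binary coproducts `X ⊔ Y` of formal coproducts (first clause of "of finitely
connected type"). [cite: MochizukiFrdI2008, §0 p.16] -/
theorem hasBinaryCoproduct_finiteCoproductCompletion (X Y : FiniteCoproductCompletion.{w} C) :
    HasBinaryCoproduct X Y := by
  haveI : Finite X.obj.I := X.property
  haveI : Finite Y.obj.I := Y.property
  exact HasColimit.mk ⟨_, sumIsColimitSub X Y (show Finite (X.obj.I ⊕ Y.obj.I) from inferInstance)⟩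

/-- `C^⊤` has the binary coproducts `X ⊔ Y` of formal coproducts. [cite: MochizukiFrdI2008, §0 p.16] -/
theorem hasBinaryCoproduct_countableCoproductCompletion (X Y : CountableCoproductCompletion.{w} C) :
    HasBinaryCoproduct X Y := by
  haveI : Countable X.obj.I := X.property
  haveI : Countable Y.obj.I := Y.property
  exact HasColimit.mk ⟨_, sumIsColimitSub X Y (show Countable (X.obj.I ⊕ Y.obj.I) from inferInstance)⟩

end Literature.AlgebraicGeometry.Frobenioids
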